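import Mathlib.Analysis.Complex.ExponentialBounds
import Literature.NumberTheory.QuadraticFields.ClassNumberOneBakerFundamental
import Literature.NumberTheory.QuadraticFields.RealQuadraticUnits
import Literature.NumberTheory.QuadraticFields.BakerTwoLogData
import Literature.NumberTheory.Transcendental.TwoLogarithmsLowerBound
import HarnessLib

/-!
# Baker's two logarithms: `X₂₁ = 2h(21) log ε₂₁`, `X₃₃ = 2h(33) log ε₃₃`, and small coefficients

Topic `NumberTheory/QuadraticFields`, namespace `Literature.NumberTheory.QuadraticFields.BakerLimitFormula`.
Everything here is PROVED.

* `bakerX_21`, `bakerX_33`: the quantities `X_k = √k · L(1, (·/k))` of Baker's fundamental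
  inequality (`ClassNumberOneBakerFundamental.lean`) are `2 h_k R_k` by the real class number
  formula (`LFunction_jacobiChar_one_eq_of_discr_pos`, `w_k = 2`), with
  `R₂₁ = log ((5+√21)/2)`, `R₃₃ = log (23 + 4√33)` (`RealQuadraticUnits.lean`); the class numbers
  `h(21), h(33)` are carried as integers in `[1, 64]`, `[1, 54]` (the crude `|L(1,χ)| ≤ 2k` suffices;
  in truth both are `1`). So Baker's linear form is `b₁ log ε₂₁ - b₂ log ε₃₃` with positive integers
  `b₁, b₂` (Baker 1975, p. 51: "`|b log ε + b' log ε'| < e^{-δB}`").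
* `abs_linearForm_ge_of_le` — the Liouville bound for SMALL coefficients:
  `|u log ε₂₁ - v log ε₃₃| ≥ e^{-(28T+4)}` for `1 ≤ u ≤ T`, `0 ≤ v ≤ T` (the algebraic integer
  `ε₂₁ᵘ ε₃₃⁻ᵛ - 1 ≠ 0` of `ℚ(ε₂₁, ε₃₃)` has conjugates `≤ 2·93^{2T}` and degree `≤ 4`).

## References

* A. Baker, *Transcendental Number Theory* (1975), Ch. 5 §4 (p. 51). [Baker1975]
* A. Baker, G. Wüstholz, *Logarithmic Forms and Diophantine Geometry* (2007), §3.1 p. 36–37.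
  [BakerWustholz2007]
-/

noncomputable section

open Real Complex Module NumberField NumberField.Units
open Literature.NumberTheory.QuadraticFields.Quadratic Literature.NumberTheory.QuadraticFields.BakerTwoLog
open Literature.NumberTheory.Transcendental
open scoped NumberTheorySymbols

namespace Literature.NumberTheory.QuadraticFields.BakerLimitFormula

/-! ### Numerical facts about the two logarithms -/

/-- `e < 2.72` and `2.7 < e`. [folklore] -/
theorem exp_one_bounds : 2.7 < Real.exp 1 ∧ Real.exp 1 < 2.72 := by
  constructor
  · have := Real.exp_one_gt_d9; linarith
  · have := Real.exp_one_lt_d9; linarith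

/-- `3/2 < log ε₂₁` (`e³ < 22 < ε₂₁²`). [folklore] -/
theorem three_half_lt_log_e21 : 3 / 2 < Real.log e21 := by
  have he := exp_one_bounds
  have h21 := one_lt_e21
  rw [Real.lt_log_iff_exp_lt (by linarith)]
  have h1 : Real.exp (3 / 2) ^ 2 < e21 ^ 2 := by
    rw [← Real.exp_nat_mul, e21_sq]
    norm_num
    have : Real.exp 3 = Real.exp 1 ^ 3 := by rw [← Real.exp_nat_mul]; norm_num
    rw [this]
    have h5 : (4.7 : ℝ) < e21 := by unfold e21; have := sqrt21_bounds; nlinarith [sqrt21_sq]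
    have h3 : Real.exp 1 ^ 3 < 2.72 ^ 3 := pow_lt_pow_left₀ he.2 (by positivity) (by norm_num)
    linarith
  exact lt_of_pow_lt_pow_left₀ 2 (by linarith) h1

/-- `log ε₂₁ < 8/5` (`ε₂₁⁵ < 4.8⁵ < e⁸`). [folklore] -/
theorem log_e21_lt : Real.log e21 < 8 / 5 := by
  have he := exp_one_bounds
  have h21 := one_lt_e21
  rw [Real.log_lt_iff_lt_exp (by linarith)]
  have h1 : e21 ^ 5 < Real.exp (8 / 5) ^ 5 := by
    rw [← Real.exp_nat_mul]
    norm_num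
    have : Real.exp 8 = Real.exp 1 ^ 8 := by rw [← Real.exp_nat_mul]; norm_num
    rw [this]
    have h5 : e21 < 4.8 := by unfold e21; have := sqrt21_bounds; nlinarith [sqrt21_sq]
    have h6 : e21 ^ 5 < 4.8 ^ 5 := pow_lt_pow_left₀ h5 (by linarith) (by norm_num)
    have h7 : (2.7 : ℝ) ^ 8 < Real.exp 1 ^ 8 := pow_lt_pow_left₀ he.1 (by norm_num) (by norm_num)
    linarith
  exact lt_of_pow_lt_pow_left₀ 5 (by positivity) h1

/-- `7/2 < log ε₃₃` (`e⁷ < 1100 < ε₃₃²`). [folklore] -/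
theorem seven_half_lt_log_e33 : 7 / 2 < Real.log e33 := by
  have he := exp_one_bounds
  have h33 := one_lt_e33
  rw [Real.lt_log_iff_exp_lt (by linarith)]
  have h1 : Real.exp (7 / 2) ^ 2 < e33 ^ 2 := by
    rw [← Real.exp_nat_mul, e33_sq]
    norm_num
    have : Real.exp 7 = Real.exp 1 ^ 7 := by rw [← Real.exp_nat_mul]; norm_num
    rw [this]
    have h5 : (45 : ℝ) < e33 := by unfold e33; have := sqrt33_bounds; nlinarith [sqrt33_sq]
    have h3 : Real.exp 1 ^ 7 < 2.72 ^ 7 := pow_lt_pow_left₀ he.2 (by positivity) (by norm_num)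
    linarith
  exact lt_of_pow_lt_pow_left₀ 2 (by linarith) h1

/-- `log ε₃₃ < 4` (`ε₃₃ < 47 < e⁴`). [folklore] -/
theorem log_e33_lt : Real.log e33 < 4 := by
  have he := exp_one_bounds
  have h33 := one_lt_e33
  rw [Real.log_lt_iff_lt_exp (by linarith)]
  have : Real.exp 4 = Real.exp 1 ^ 4 := by rw [← Real.exp_nat_mul]; norm_num
  rw [this]
  have h5 := e33_lt
  have h3 : (2.7 : ℝ) ^ 4 < Real.exp 1 ^ 4 := pow_lt_pow_left₀ he.1 (by norm_num) (by norm_num)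
  linarith

/-! ### The values `X₂₁`, `X₃₃` -/

/-- `21 = 3 · 7` is square-free. [folklore] -/
theorem squarefree_21 : Squarefree (21 : ℕ) := by
  rw [show (21 : ℕ) = 3 * 7 by norm_num, Nat.squarefree_mul (by norm_num)]
  exact ⟨Nat.prime_three.squarefree, (by norm_num : Nat.Prime 7).squarefree⟩

/-- `33 = 3 · 11` is square-free. [folklore] -/
theorem squarefree_33 : Squarefree (33 : ℕ) := by
  rw [show (33 : ℕ) = 3 * 11 by norm_num, Nat.squarefree_mul (by norm_num)]
  exact ⟨Nat.prime_three.squarefree, (by norm_num : Nat.Prime 11).squarefree⟩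

/-- Transport of `L(1, jacobiChar n)` along an equality of moduli. [folklore] -/
theorem LFunction_jacobiChar_congr {n : ℕ} [NeZero n] {n' : ℕ} [NeZero n'] (h : n = n') :
    (jacobiChar n).LFunction 1 = (jacobiChar n').LFunction 1 := by
  subst h; rfl

/-- **`X₂₁ = 2 h(21) log ε₂₁`** with `1 ≤ h(21) ≤ 64` (`h(21)` the class number of `ℚ(√21)`).
[cite: BakerWustholz2007, §3.1 p. 36] -/
theorem bakerX_21 : ∃ h : ℕ, 1 ≤ h ∧ h ≤ 64 ∧ bakerX 21 = ((2 * h * Real.log e21 : ℝ) : ℂ) := by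
  have hsq : Squarefree (21 : ℤ) := by
    rw [← Int.squarefree_natAbs]; exact squarefree_21
  obtain ⟨K, _, _, h2, hd⟩ := exists_numberField_discr_eq (D := 21) (Or.inl ⟨by norm_num, hsq, by norm_num⟩)
  obtain ⟨b, hb⟩ := exists_basis_zero_eq_one (K := K) h2
  have hodd : Odd (NumberField.discr K) := by rw [hd]; decide
  have hpos : 0 < NumberField.discr K := by rw [hd]; norm_num
  haveI : NeZero (NumberField.discr K).natAbs := neZero_natAbs_discr
  have hL := LFunction_jacobiChar_one_eq_of_discr_pos h2 hodd hpos
  have hreg := regulator_eq_log_21 b hb h2 hd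
  have htor := torsionOrder_eq_two_of_discr_pos h2 hpos
  have h21 : (NumberField.discr K).natAbs = 21 := by rw [hd]; rfl
  rw [LFunction_jacobiChar_congr h21, hreg, htor] at hL
  have hdr : (NumberField.discr K : ℝ) = 21 := by exact_mod_cast hd
  rw [hdr] at hL
  have he21 : Real.log ((5 + Real.sqrt 21) / 2) = Real.log e21 := rfl
  rw [he21] at hL
  -- the value of `X₂₁`
  have hs0 : (0 : ℝ) < Real.sqrt 21 := Real.sqrt_pos.mpr (by norm_num)
  have hX : bakerX 21 = ((2 * classNumber K * Real.log e21 : ℝ) : ℂ) := by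
    rw [bakerX_def, hL, ← Complex.ofReal_mul]
    congr 1
    field_simp
    push_cast
    ring
  refine ⟨classNumber K, classNumber_pos K, ?_, hX⟩
  -- the bound `h ≤ 64` from `|L(1, χ₂₁)| ≤ 42`
  have hχ : jacobiChar 21 ≠ 1 := jacobiChar_ne_one (by decide) squarefree_21 (by norm_num)
  have hbound := Literature.NumberTheory.LFunctions.DirichletAbel.norm_sum_div_sub_LFunction_one_le_level
    (jacobiChar 21) hχ 0
  simp only [Finset.range_zero, Finset.sum_empty, zero_sub, norm_neg, Nat.cast_zero, zero_add,
    div_one] at hbound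
  rw [hL, Complex.norm_real, Real.norm_eq_abs] at hbound
  have hlog := three_half_lt_log_e21
  have hs5 : Real.sqrt 21 < 4.6 := by nlinarith [sqrt21_sq, Real.sqrt_nonneg 21]
  have hh0 : (0 : ℝ) ≤ classNumber K := Nat.cast_nonneg _
  have hval : 4 * Real.log e21 * (classNumber K : ℝ) / ((2 : ℕ) * Real.sqrt 21) =
      2 * Real.log e21 * classNumber K / Real.sqrt 21 := by push_cast; field_simp; ring
  rw [hval, abs_of_nonneg (by positivity), div_le_iff₀ hs0] at hbound
  have h3 : 3 * (classNumber K : ℝ) ≤ 2 * Real.log e21 * classNumber K := by nlinarith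
  push_cast at hbound
  have : (classNumber K : ℝ) < 65 := by nlinarith
  exact_mod_cast Nat.lt_succ_iff.mp (by exact_mod_cast this : classNumber K < 65)

/-- **`X₃₃ = 2 h(33) log ε₃₃`** with `1 ≤ h(33) ≤ 54`. [cite: BakerWustholz2007, §3.1 p. 36] -/
theorem bakerX_33 : ∃ h : ℕ, 1 ≤ h ∧ h ≤ 54 ∧ bakerX 33 = ((2 * h * Real.log e33 : ℝ) : ℂ) := by
  have hsq : Squarefree (33 : ℤ) := by
    rw [← Int.squarefree_natAbs]; exact squarefree_33
  obtain ⟨K, _, _, h2, hd⟩ := exists_numberField_discr_eq (D := 33) (Or.inl ⟨by norm_num, hsq, by norm_num⟩)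
  obtain ⟨b, hb⟩ := exists_basis_zero_eq_one (K := K) h2
  have hodd : Odd (NumberField.discr K) := by rw [hd]; decide
  have hpos : 0 < NumberField.discr K := by rw [hd]; norm_num
  haveI : NeZero (NumberField.discr K).natAbs := neZero_natAbs_discr
  have hL := LFunction_jacobiChar_one_eq_of_discr_pos h2 hodd hpos
  have hreg := regulator_eq_log_33 b hb h2 hd
  have htor := torsionOrder_eq_two_of_discr_pos h2 hpos
  have h33 : (NumberField.discr K).natAbs = 33 := by rw [hd]; rfl
  rw [LFunction_jacobiChar_congr h33, hreg, htor] at hL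
  have hdr : (NumberField.discr K : ℝ) = 33 := by exact_mod_cast hd
  rw [hdr] at hL
  have he33 : Real.log (23 + 4 * Real.sqrt 33) = Real.log e33 := rfl
  rw [he33] at hL
  have hs0 : (0 : ℝ) < Real.sqrt 33 := Real.sqrt_pos.mpr (by norm_num)
  have hX : bakerX 33 = ((2 * classNumber K * Real.log e33 : ℝ) : ℂ) := by
    rw [bakerX_def, hL, ← Complex.ofReal_mul]
    congr 1
    field_simp
    push_cast
    ring
  refine ⟨classNumber K, classNumber_pos K, ?_, hX⟩
  have hχ : jacobiChar 33 ≠ 1 := jacobiChar_ne_one (by decide) squarefree_33 (by norm_num)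
  have hbound := Literature.NumberTheory.LFunctions.DirichletAbel.norm_sum_div_sub_LFunction_one_le_level
    (jacobiChar 33) hχ 0
  simp only [Finset.range_zero, Finset.sum_empty, zero_sub, norm_neg, Nat.cast_zero, zero_add,
    div_one] at hbound
  rw [hL, Complex.norm_real, Real.norm_eq_abs] at hbound
  have hlog := seven_half_lt_log_e33
  have hs6 : Real.sqrt 33 < 5.75 := by nlinarith [sqrt33_sq, Real.sqrt_nonneg 33]
  have hh0 : (0 : ℝ) ≤ classNumber K := Nat.cast_nonneg _
  have hval : 4 * Real.log e33 * (classNumber K : ℝ) / ((2 : ℕ) * Real.sqrt 33) =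
      2 * Real.log e33 * classNumber K / Real.sqrt 33 := by push_cast; field_simp; ring
  rw [hval, abs_of_nonneg (by positivity), div_le_iff₀ hs0] at hbound
  have h3 : 7 * (classNumber K : ℝ) ≤ 2 * Real.log e33 * classNumber K := by nlinarith
  push_cast at hbound
  have : (classNumber K : ℝ) < 55 := by nlinarith
  exact_mod_cast Nat.lt_succ_iff.mp (by exact_mod_cast this : classNumber K < 55)

/-! ### Small coefficients: Liouville -/

/-- `ε₃₃ (46 - ε₃₃) = 1`. [folklore] -/
theorem e33_mul_conj : e33 * (46 - e33) = 1 := by have := e33_sq; nlinarith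

/-- `log 16 ≤ 4` and `log 93 ≤ 14/3`. [folklore] -/
theorem log_bounds_16_93 : Real.log 16 ≤ 4 ∧ Real.log 93 ≤ 14 / 3 := by
  have he := exp_one_bounds
  constructor
  · rw [Real.log_le_iff_le_exp (by norm_num)]
    have h1 : Real.exp 4 = Real.exp 1 ^ 4 := by rw [← Real.exp_nat_mul]; norm_num
    have h2 : (2.7 : ℝ) ^ 4 ≤ Real.exp 1 ^ 4 := pow_le_pow_left₀ (by norm_num) he.1.le 4
    rw [h1]; nlinarith
  · rw [Real.log_le_iff_le_exp (by norm_num)]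
    have h1 : Real.exp (14 / 3) = Real.exp 1 ^ 4 * Real.exp (2 / 3) := by
      rw [← Real.exp_nat_mul, ← Real.exp_add]; norm_num
    have h2 : 1 + 2 / 3 + (2 / 3) ^ 2 / 2 ≤ Real.exp (2 / 3 : ℝ) :=
      Real.quadratic_le_exp_of_nonneg (by norm_num)
    have h3 : (2.7 : ℝ) ^ 4 ≤ Real.exp 1 ^ 4 := pow_le_pow_left₀ (by norm_num) he.1.le 4
    rw [h1]; nlinarith [Real.exp_pos (2 / 3 : ℝ)]

/-- **Liouville's bound for small coefficients**: for integers `1 ≤ u ≤ T`, `0 ≤ v ≤ T`,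
`|u log ε₂₁ - v log ε₃₃| ≥ e^{-(28T + 4)}`. [cite: Baker1975, Ch. 2 Lemma 6 (the norm argument)] -/
theorem abs_linearForm_ge_of_le {u v T : ℕ} (hu : 1 ≤ u) (huT : u ≤ T) (hvT : v ≤ T) :
    Real.exp (-(28 * T + 4)) ≤ |u * Real.log e21 - v * Real.log e33| := by
  obtain ⟨Λ, hΛ⟩ : ∃ Λ : ℝ, Λ = u * Real.log e21 - v * Real.log e33 := ⟨_, rfl⟩
  rw [← hΛ]
  have hT0 : (0 : ℝ) ≤ T := Nat.cast_nonneg T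
  by_cases h1 : 1 ≤ |Λ|
  · refine le_trans ?_ h1
    rw [Real.exp_le_one_iff]; linarith
  push Not at h1
  have h21 := one_lt_e21
  have h33 := one_lt_e33
  -- `e^Λ = ε₂₁ᵘ (46 - ε₃₃)ᵛ`
  have hinv : e33⁻¹ = 46 - e33 := inv_eq_of_mul_eq_one_right e33_mul_conj
  have hexpΛ : Real.exp Λ = e21 ^ u * (46 - e33) ^ v := by
    rw [hΛ, Real.exp_sub, Real.exp_nat_mul, Real.exp_nat_mul, Real.exp_log (by linarith),
      Real.exp_log (by linarith), div_eq_mul_inv, ← inv_pow, hinv]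
  -- the algebraic integer `Y = ε₂₁ᵘ (46 - ε₃₃)ᵛ - 1` of `F = ℚ(ε₂₁, ε₃₃)`
  obtain ⟨Y, hY⟩ : ∃ Y : 𝓞 fld, Y = a21 ^ u * (46 - a33) ^ v - 1 := ⟨_, rfl⟩
  set ψ : 𝓞 fld →+* ℂ := (algebraMap fld ℂ).comp (algebraMap (𝓞 fld) fld) with hψ
  have hψ21 : ψ a21 = ((e21 : ℝ) : ℂ) := algebraMap_a21
  have hψ33 : ψ a33 = ((e33 : ℝ) : ℂ) := algebraMap_a33
  have hψY : algebraMap fld ℂ (Y : fld) = ((Real.exp Λ - 1 : ℝ) : ℂ) := by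
    rw [show algebraMap fld ℂ (Y : fld) = ψ Y from rfl, hY, map_sub, map_one, map_mul, map_pow,
      map_pow, map_sub, map_ofNat, hψ21, hψ33, hexpΛ]
    push_cast; ring
  have hYne : Y ≠ 0 := by
    intro h0
    have h2 : ((Real.exp Λ - 1 : ℝ) : ℂ) = 0 := by rw [← hψY, h0]; simp
    have h3 : Real.exp Λ = 1 := by
      have := Complex.ofReal_eq_zero.mp h2; linarith
    have h4 : Λ = 0 := by
      rw [← Real.exp_zero] at h3; exact Real.exp_injective h3
    have h5 := add_log_injective (a₁ := (u, 0)) (a₂ := (0, v))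
      (by push_cast; rw [hΛ] at h4; linarith)
    simp only [Prod.mk.injEq] at h5
    omega
  -- conjugate bound `2 · 93^{2T}`
  have hconj : ∀ σ : fld →+* ℂ, ‖σ (Y : fld)‖ ≤ 2 * 93 ^ (2 * T) := by
    intro σ
    set σ' : 𝓞 fld →+* ℂ := σ.comp (algebraMap (𝓞 fld) fld) with hσ'
    have e1 : σ (Y : fld) = σ' Y := rfl
    rw [e1, hY, map_sub, map_one, map_mul, map_pow, map_pow, map_sub, map_ofNat]
    have ha : ‖σ' a21‖ ≤ 47 := norm_conj_a21_le σ
    have hb : ‖(46 : ℂ) - σ' a33‖ ≤ 93 := by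
      calc ‖(46 : ℂ) - σ' a33‖ ≤ ‖(46 : ℂ)‖ + ‖σ' a33‖ := norm_sub_le _ _
        _ ≤ 46 + 47 := add_le_add (by simp) (norm_conj_a33_le σ)
        _ = 93 := by norm_num
    have h93 : (1 : ℝ) ≤ 93 := by norm_num
    calc ‖σ' a21 ^ u * ((46 : ℂ) - σ' a33) ^ v - 1‖
        ≤ ‖σ' a21 ^ u * ((46 : ℂ) - σ' a33) ^ v‖ + ‖(1 : ℂ)‖ := norm_sub_le _ _
      _ = ‖σ' a21‖ ^ u * ‖(46 : ℂ) - σ' a33‖ ^ v + 1 := by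
          rw [norm_mul, norm_pow, norm_pow, norm_one]
      _ ≤ 93 ^ T * 93 ^ T + 1 := by
          have hu' : ‖σ' a21‖ ^ u ≤ 93 ^ T :=
            calc ‖σ' a21‖ ^ u ≤ 47 ^ u := pow_le_pow_left₀ (norm_nonneg _) ha u
              _ ≤ 93 ^ u := pow_le_pow_left₀ (by norm_num) (by norm_num) u
              _ ≤ 93 ^ T := pow_le_pow_right₀ h93 huT
          have hv' : ‖(46 : ℂ) - σ' a33‖ ^ v ≤ 93 ^ T :=
            calc ‖(46 : ℂ) - σ' a33‖ ^ v ≤ 93 ^ v := pow_le_pow_left₀ (norm_nonneg _) hb v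
              _ ≤ 93 ^ T := pow_le_pow_right₀ h93 hvT
          have := mul_le_mul hu' hv' (by positivity) (by positivity)
          linarith
      _ ≤ 2 * 93 ^ (2 * T) := by
          rw [two_mul (T), pow_add]
          have : (1 : ℝ) ≤ 93 ^ T * 93 ^ T := one_le_mul_of_one_le_of_one_le (one_le_pow₀ h93) (one_le_pow₀ h93)
          linarith
  have hB1 : (1 : ℝ) ≤ 2 * 93 ^ (2 * T) := by
    have := one_le_pow₀ (show (1 : ℝ) ≤ 93 by norm_num) (n := 2 * T); linarith
  have hLiou := TwoLog.liouville (algebraMap fld ℂ) hYne hB1 hconj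
  rw [hψY, Complex.norm_real, Real.norm_eq_abs] at hLiou
  -- `|e^Λ - 1| ≤ 2|Λ|`
  have hexp : |Real.exp Λ - 1| ≤ 2 * |Λ| := Real.abs_exp_sub_one_le h1.le
  -- degree `≤ 4`
  have hfr : Module.finrank ℚ fld - 1 ≤ 3 := by have := finrank_fld_le; omega
  have hpow : ((2 * 93 ^ (2 * T) : ℝ) ^ 3)⁻¹ ≤ ((2 * 93 ^ (2 * T) : ℝ) ^ (Module.finrank ℚ fld - 1))⁻¹ := by
    apply inv_anti₀ (by positivity)
    exact pow_le_pow_right₀ hB1 hfr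
  have hmain : ((2 * 93 ^ (2 * T) : ℝ) ^ 3)⁻¹ / 2 ≤ |Λ| := by linarith [hpow.trans hLiou]
  refine le_trans ?_ hmain
  -- numerics: `(2·93^{2T})^{-3}/2 = exp(-(log 16 + 6T log 93)) ≥ exp(-(28T + 4))`
  obtain ⟨hlog16, hlog93⟩ := log_bounds_16_93
  have hRHS : ((2 * 93 ^ (2 * T) : ℝ) ^ 3)⁻¹ / 2 = Real.exp (-(Real.log 16 + 6 * T * Real.log 93)) := by
    have h93 : Real.exp (Real.log 16 + 6 * T * Real.log 93) = 16 * ((93 : ℝ) ^ (2 * T)) ^ 3 := by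
      rw [Real.exp_add, Real.exp_log (by norm_num : (0 : ℝ) < 16),
        show (6 * T * Real.log 93 : ℝ) = ((2 * T * 3 : ℕ) : ℝ) * Real.log 93 by push_cast; ring,
        ← Real.log_pow, Real.exp_log (by positivity), pow_mul]
    rw [Real.exp_neg, h93, mul_pow]
    have hq : (0 : ℝ) < ((93 : ℝ) ^ (2 * T)) ^ 3 := by positivity
    field_simp
    norm_num
  rw [hRHS, Real.exp_le_exp, neg_le_neg_iff]
  have : 6 * (T : ℝ) * Real.log 93 ≤ 6 * T * (14 / 3) := mul_le_mul_of_nonneg_left hlog93 (by positivity)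
  linarith

end Literature.NumberTheory.QuadraticFields.BakerLimitFormula

end
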